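import Summits.ResolutionOfSingularities.ResolutionOfSingularities.Theorems.ValuativeLuAlphaPTorsorDiscreteAllDimMem
import Summits.ResolutionOfSingularities.ResolutionOfSingularities.Theorems.ValuativeLuAlphaPTorsorDiscreteAllDimInitialDerivation
import Summits.ResolutionOfSingularities.ResolutionOfSingularities.Theorems.ValuativeLuAlphaPTorsorDiscreteAllDimChain
import Summits.ResolutionOfSingularities.ResolutionOfSingularities.Theorems.ValuativeLuAlphaPTorsorDiscreteAllDimRounds
import Summits.ResolutionOfSingularities.ResolutionOfSingularities.Theorems.ValuativeLuAlphaPTorsorDiscreteAllDimHelpers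
import Summits.ResolutionOfSingularities.ResolutionOfSingularities.Theorems.ValuativeLuAlphaPTorsorDiscreteDescent
import Summits.ResolutionOfSingularities.ResolutionOfSingularities.Theorems.ValuativeLuAlphaPTorsorLogPrincipalizationDimTwo
import Summits.ResolutionOfSingularities.ResolutionOfSingularities.Theorems.ValuativeLuAlphaPTorsorLowDim
import Summits.ResolutionOfSingularities.ResolutionOfSingularities.Theorems.ValuativeLuAlphaPTorsorResidueExit
import Summits.ResolutionOfSingularities.ResolutionOfSingularities.Theorems.ValuativeLuAlphaPTorsorModelDerivations
import Literature.AlgebraicGeometry.Resolution.RegularSystemOfParameters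

/-!
# `LuAlphaPTorsor` along discrete rank-one valuations, all dimensions: schema facts and exits

Crux `Valuative.LuAlphaPTorsor` (item `stmt-ResolutionOfSingularities-0641`), line
`pfaff-line-log-final-forms`, branch `DiscreteAllDim`. This file holds the pieces of the assembly
of the registered target `luAlphaPTorsor_of_discrete` (next file, `…DiscreteAllDim.lean`) that
live on ONE member of the sequence: valuation bookkeeping in a dominated subring, the two schema
facts consumed by the rounds (`sq_or_unit_derivative_dad`, `res_or_unit_derivative_dad`), and the
transport of an exit datum to a finitely generated model (registered sub-goal
`exit_of_datum_dad`). The target it serves: for `k` of characteristic `p`, `O` a valuation ring of `K ⊇ k`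
whose value group is DISCRETE OF RANK ONE (every non-zero value an integral power of the value
of one element `π ∈ 𝔪_O`), `A₀ ⊆ O` finitely generated and regular at the centre — of ANY
dimension —, `t ^ p ∈ A₀` with `Frac (A₀[t]) = K`: some finitely generated `A ⊇ A₀[t]` inside
`O` with `Frac A = K` is regular at the centre.

This is a new TRUE range inside the open core of the crux (base dimension `≥ 3`), containing
NON-Abhyankar valuations (e.g. zero-dimensional discrete valuations = transcendental arcs on
threefolds and higher), obtained by an elementary dimension-free argument:

* the quadratic sequence `R 0 → R 1 → ⋯` of the pulled-back base inside `K₀ = Frac A₀` along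
  `ν₀ = ν|K₀` (discrete of rank one by `discrete_descent`) eventually contains a generator `π`
  of the value group (`discreteAllDim_mem` — an elementary substitute for Abhyankar's union
  lemma) and is then in the free `π`-chart regime (`div_mem_of_step`);
* at such a stage the radicand `a = t ^ p` (not a `p`-th power, `forall_ne_pow_sequence`) has a
  derivative `D a ≠ 0` (`exists_derivation_apply_ne_zero`), and the dual derivations of a
  regular system of parameters starting with `π` (`exists_rsop_cons`, `exists_dual_derivations_centre`,
  `duals_of_ringEquiv_fin`, extended to the field by `fieldDerivation_of_subring`) give a field
  derivation `D₀` killing a chart element `π'` of the same value with `D₀ a ≠ 0`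
  (`discreteAllDim_initialDerivation`);
* the derivation chain `h i • D₀` (`discreteAllDim_chain`) and the approximation rounds with
  the dimension-free slack descent (`discreteAllDim_rounds`; the schema facts "unit derivative
  or `𝔪²`" and "unit derivative or `p`-th power residue" are supplied here from dual derivations
  and residual richness `exists_derivation_isUnit_of_residue_ne_pow`) end in a monogenic or a
  toroidal exit datum on some member `R i`;
* `R i` is the local ring of a finitely generated model `A₁` (`exists_model_of_sequence_member`);
  transporting along `R i ≃ (A₁)_centre`, the landed `stub_monogenicExit` / `stub_toroidalExit`
  give the regular model. Members of dimension `≤ 1` and a base of dimension `≤ 1` are finished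
  by `logPrincipalization_of_ringKrullDim_le_one` through `luAlphaPTorsor_of_ringKrullDim_le_one`;
  a radicand which is a `p`-th power at the centre by `stub_birationalExit`.
-/

set_option linter.dupNamespace false

noncomputable section

namespace Summit.ResolutionOfSingularities.ResolutionOfSingularities.Theorems.PfaffLine

open IsLocalRing Literature.AlgebraicGeometry.Resolution DiscreteRounds DiscreteFree


/-! ## Valuation bookkeeping in a dominated subring -/

section bookkeeping

variable {K' : Type} [Field K'] {O' : ValuationSubring K'} {S : Subring K'}

/-- Non-units of a subring dominated by `O'` have value `< 1` (zero included). [folklore] -/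
theorem valuation_lt_one_of_not_isUnit_dad [IsLocalRing S] (hS : SubringDominates S O'.toSubring)
    {z : S} (hz : ¬ IsUnit z) : O'.valuation (z : K') < 1 :=
  ((subringDominates_valuationSubring_iff hS.1).mp hS z).mp
    ((IsLocalRing.mem_maximalIdeal z).mpr (mem_nonunits_iff.mpr hz))

/-- A unit plus a non-unit of a local ring is a unit. [folklore] -/
theorem isUnit_of_sub_mem_maximalIdeal_dad {L : Type*} [CommRing L] [IsLocalRing L] {x y : L}
    (hy : IsUnit y) (h : x - y ∈ maximalIdeal L) : IsUnit x := by
  rw [← residue_ne_zero_iff_isUnit] at hy ⊢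
  rw [← residue_eq_zero_iff, map_sub, sub_eq_zero] at h
  rwa [h]

/-- Elements of `𝔪²` of a subring dominated by `O'` have value `≤ v(π)²` when `v(π)` is the
largest value `< 1`. [folklore] -/
theorem valuation_le_sq_of_mem_sq_dad [IsLocalRing S] (hS : SubringDominates S O'.toSubring)
    {π : K'} (hmax : ∀ z : K', O'.valuation z < 1 → O'.valuation z ≤ O'.valuation π) {z : S}
    (hz : z ∈ maximalIdeal S ^ 2) : O'.valuation (z : K') ≤ O'.valuation π ^ 2 := by
  rw [pow_two] at hz
  refine Submodule.mul_induction_on hz (fun a ha b hb => ?_) (fun a b ha hb => ?_)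
  · rw [Subring.coe_mul, Valuation.map_mul, pow_two]
    have hva := ((subringDominates_valuationSubring_iff hS.1).mp hS a).mp ha
    have hvb := ((subringDominates_valuationSubring_iff hS.1).mp hS b).mp hb
    exact mul_le_mul' (hmax _ hva) (hmax _ hvb)
  · rw [Subring.coe_add]
    exact (Valuation.map_add _ _ _).trans (max_le ha hb)

/-- An element of the largest value `< 1` is not in `𝔪²`. [folklore] -/
theorem not_mem_sq_of_valuation_eq_dad [IsLocalRing S] (hS : SubringDominates S O'.toSubring)
    {π : K'} (hπ0 : π ≠ 0) (hπ1 : O'.valuation π < 1)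
    (hmax : ∀ z : K', O'.valuation z < 1 → O'.valuation z ≤ O'.valuation π) {z : S}
    (hz : O'.valuation (z : K') = O'.valuation π) : z ∉ maximalIdeal S ^ 2 := by
  intro hmem
  have h := valuation_le_sq_of_mem_sq_dad hS hmax hmem
  rw [hz, pow_two] at h
  have hγ : 0 < O'.valuation π := (Valuation.pos_iff _).mpr hπ0
  have : O'.valuation π * O'.valuation π < O'.valuation π * 1 := mul_lt_mul_of_pos_left hπ1 hγ
  rw [mul_one] at this
  exact absurd h (not_le.mpr this)

end bookkeeping

/-! ## The two schema facts of the rounds, on a regular member of the sequence -/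

section schema

variable {K' : Type} [Field K'] (O' : ValuationSubring K') (S : Subring K')

/-- **Schema fact (sq): unit derivative or `𝔪²`.** On a regular local subring `S` of `K'`
dominated by `O'`, all of whose fractions exhaust `K'` and which carries dual derivations for
its regular systems of parameters, every non-unit `f` either has a unit derivative `δ f` for a
field derivation `δ` preserving `S`, or is a sum of products of two non-units: write
`f = ∑ c_j u_j` in a regular system of parameters `u`; if some `c_j` is a unit, the dual
derivation `D_j` has `D_j f ≡ c_j (mod 𝔪)`. [folklore] -/
theorem sq_or_unit_derivative_dad [IsRegularLocalRing S] (hS : SubringDominates S O'.toSubring)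
    (hfrac : ∀ z : K', ∃ a ∈ S, ∃ b ∈ S, b ≠ 0 ∧ z = a / b)
    (hdual : ∀ (n : ℕ) (v : Fin n → S), ringKrullDim S = (n : WithBot ℕ∞) →
      (∀ z : S, z ∈ Ideal.span (Set.range v) ↔ ¬ IsUnit z) →
        ∃ D : Fin n → Derivation ℤ S S, ∀ l j, D l (v j) = if l = j then 1 else 0)
    (f : K') (hf : f ∈ S) (hvf : O'.valuation f < 1) :
    (∃ δ : Derivation ℤ K' K', (∀ z : K', z ∈ S → δ z ∈ S) ∧ δ f ≠ 0 ∧ (δ f)⁻¹ ∈ S) ∨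
      (∃ (m : ℕ) (b c : Fin m → K'), (∀ l, b l ∈ S ∧ O'.valuation (b l) < 1 ∧ c l ∈ S ∧
        O'.valuation (c l) < 1) ∧ f = Finset.univ.sum fun l => b l * c l) := by
  classical
  -- a regular system of parameters and its dual derivations
  obtain ⟨u, hu⟩ := exists_regularSystemOfParameters (R := S)
  have hdim : ringKrullDim S = ((maximalIdeal S).spanFinrank : WithBot ℕ∞) :=
    (IsRegularLocalRing.spanFinrank_maximalIdeal (R := S)).symm
  have hu' : ∀ z : S, z ∈ Ideal.span (Set.range u) ↔ ¬ IsUnit z := fun z => by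
    rw [hu, IsLocalRing.mem_maximalIdeal, mem_nonunits_iff]
  obtain ⟨D, hD⟩ := hdual _ u hdim hu'
  -- `f = ∑ c_j u_j`
  have hfm : (⟨f, hf⟩ : S) ∈ Ideal.span (Set.range u) := by
    rw [hu, IsLocalRing.mem_maximalIdeal, mem_nonunits_iff, isUnit_subring_iff_inv_mem]
    rintro ⟨hf0, hfi⟩
    exact inv_not_mem_subring_of_valuation_lt_one hS.1 hf0 hvf hfi
  obtain ⟨c, hc⟩ := Ideal.mem_span_range_iff_exists_fun.mp hfm
  have hum : ∀ l, u l ∈ maximalIdeal S := fun l => hu ▸ Ideal.subset_span ⟨l, rfl⟩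
  by_cases hunit : ∃ j, IsUnit (c j)
  · -- some coefficient is a unit: the dual derivation `D j` has `D j f` a unit
    obtain ⟨j, hj⟩ := hunit
    have hDf : IsUnit (D j ⟨f, hf⟩) := by
      refine isUnit_of_sub_mem_maximalIdeal_dad hj ?_
      have e1 : D j ⟨f, hf⟩ = c j + Finset.univ.sum fun l => u l * D j (c l) := by
        rw [← hc, map_sum]
        have e2 : ∀ l, D j (c l * u l) = (if j = l then c l else 0) + u l * D j (c l) := by
          intro l
          rw [Derivation.leibniz, hD, smul_eq_mul, smul_eq_mul, mul_ite, mul_one, mul_zero]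
        simp_rw [e2]
        rw [Finset.sum_add_distrib, Finset.sum_ite_eq]
        simp
      rw [e1, add_sub_cancel_left]
      exact Ideal.sum_mem _ fun l _ => Ideal.mul_mem_right _ _ (hum l)
    obtain ⟨δ, hδ⟩ := fieldDerivation_of_subring K' S hfrac (D j)
    have hδf : δ f = D j ⟨f, hf⟩ := hδ ⟨f, hf⟩
    have hu1 := (isUnit_subring_iff_inv_mem _).mp hDf
    refine Or.inl ⟨δ, fun z hz => ?_, ?_, ?_⟩
    · rw [hδ ⟨z, hz⟩]; exact (D j ⟨z, hz⟩).2
    · rw [hδf]; exact hu1.1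
    · rw [hδf]; exact hu1.2
  · -- all coefficients are non-units: `f ∈ 𝔪²`
    push Not at hunit
    refine Or.inr ⟨_, fun l => (c l : K'), fun l => (u l : K'), fun l => ⟨(c l).2,
      valuation_lt_one_of_not_isUnit_dad hS (hunit l), (u l).2,
      valuation_lt_one_of_not_isUnit_dad hS ((hu' (u l)).mp (Ideal.subset_span ⟨l, rfl⟩))⟩, ?_⟩
    have e := congrArg (fun z : S => (z : K')) hc
    simp only [AddSubmonoidClass.coe_finsetSum, Subring.coe_mul] at e
    exact e.symm

/-- **Schema fact (res): unit derivative or `p`-th power residue.** On a regular local subring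
`S` of `K'` dominated by `O'`, presented as a quotient of a localized polynomial ring over a
field of characteristic `p`, and whose fractions exhaust `K'`, every unit `w` either has a unit
derivative `δ w` for a field derivation `δ` preserving `S`, or is congruent to a `p`-th power
modulo the non-units (residual richness `exists_derivation_isUnit_of_residue_ne_pow`).
[folklore] -/
theorem res_or_unit_derivative_dad {k : Type} [Field k] {p : ℕ} (hp : p.Prime) [CharP k p]
    [IsRegularLocalRing S] (hS : SubringDominates S O'.toSubring)
    (hfrac : ∀ z : K', ∃ a ∈ S, ∃ b ∈ S, b ≠ 0 ∧ z = a / b)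
    {m : ℕ} (𝔮 : Ideal (MvPolynomial (Fin m) k)) [𝔮.IsPrime] (Φq : Localization.AtPrime 𝔮 →+* S)
    (hsurj : Function.Surjective Φq) (w : K') (hw : w ∈ S) :
    (∃ δ : Derivation ℤ K' K', (∀ z : K', z ∈ S → δ z ∈ S) ∧ δ w ≠ 0 ∧ (δ w)⁻¹ ∈ S) ∨
      (∃ e : K', e ∈ S ∧ O'.valuation (w - e ^ p) < 1) := by
  by_cases hres : ∀ e : S, residue S ⟨w, hw⟩ ≠ residue S e ^ p
  · obtain ⟨D, hD⟩ := exists_derivation_isUnit_of_residue_ne_pow hp 𝔮 Φq hsurj hres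
    obtain ⟨δ, hδ⟩ := fieldDerivation_of_subring K' S hfrac D
    have hu1 := (isUnit_subring_iff_inv_mem _).mp hD
    refine Or.inl ⟨δ, fun z hz => ?_, ?_, ?_⟩
    · rw [hδ ⟨z, hz⟩]; exact (D ⟨z, hz⟩).2
    · rw [hδ ⟨w, hw⟩]; exact hu1.1
    · rw [hδ ⟨w, hw⟩]; exact hu1.2
  · push Not at hres
    obtain ⟨e, he⟩ := hres
    refine Or.inr ⟨e, e.2, ?_⟩
    have hmem : (⟨w, hw⟩ : S) - e ^ p ∈ maximalIdeal S := by
      rw [← residue_eq_zero_iff, map_sub, map_pow, he, sub_self]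
    exact ((subringDominates_valuationSubring_iff hS.1).mp hS _).mp hmem

end schema

/-! ## From an exit datum on a member of the sequence to the regular model -/

/-- **The exits, transported to a finitely generated model.** In the setting of
`exists_model_of_sequence_member` (a sequence `R` of quadratic transforms along `O.comap ι`
starting at the local ring of the pulled-back base, `A₀` finitely generated inside the range of
the field embedding `ι`), suppose the member `R i` carries, for the pull-back `a` of the
radicand `t ^ p`, either a MONOGENIC exit datum (`a - c^p = g^p b` with `δ b` a unit for a
field derivation `δ` preserving `R i`) or a TOROIDAL one (`a - c^p = ϖ^N w`, `w` a unit,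
`p ∤ N`, `ϖ ∈ 𝔪 ∖ 𝔪²`). Then the crux's conclusion holds: `R i ≃ (A₁)_centre` for a finitely
generated model `A₁ ⊇ A₀` (`exists_model_of_sequence_member`); derivations restrict
(`subringDerivation_of_field`) and transport (`exists_derivation_transport_ringEquiv`), a
regular system of parameters starting with `ϖ` exists (`exists_rsop_cons`) and transports, and
the landed `stub_monogenicExit` / `stub_toroidalExit` apply on `A₁`. [folklore] -/
theorem exit_of_datum_dad :
    ∀ (p : ℕ), p.Prime → ∀ (k K K' : Type) [Field k] [CharP k p] [Field K] [Algebra k K] [Field K'] (ι : K' →+* K) (O : ValuationSubring K) (A₀ : Subalgebra k K) (h₀ : A₀.toSubring ≤ O.toSubring) (t : K), A₀.FG → t ^ p ∈ A₀ → IsFractionRing (Algebra.adjoin k (insert t (A₀ : Set K))) K → A₀.toSubring ≤ ι.range → ∀ (R : ℕ → Subring K'), R 0 = Literature.AlgebraicGeometry.Resolution.locAtCentre (A₀.toSubring.comap ι) (O.comap ι) → (∀ i, Literature.AlgebraicGeometry.Resolution.IsQuadraticTransformAlong (O.comap ι) (R i) (R (i + 1))) → ∀ (i : ℕ) [IsRegularLocalRing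 (R i)] (a : R i), ι a = t ^ p → ∀ (c : K'), c ∈ R i → ((∃ (g b : K') (δ : Derivation ℤ K' K'), g ∈ R i ∧ b ∈ R i ∧ g ≠ 0 ∧ (∀ z : K', z ∈ R i → δ z ∈ R i) ∧ δ b ≠ 0 ∧ (δ b)⁻¹ ∈ R i ∧ (a : K') - c ^ p = g ^ p * b) ∨ (∃ (ϖ w : K') (N : ℕ) (hϖ : ϖ ∈ R i), w ∈ R i ∧ w⁻¹ ∈ R i ∧ w ≠ 0 ∧ ¬ p ∣ N ∧ (⟨ϖ, hϖ⟩ : R i) ∈ IsLocalRing.maximalIdeal (R i) ∧ (⟨ϖ, hϖ⟩ : R i) ∉ IsLocalRing.maximalIdeal (R i) ^ 2 ∧ (a : K') - c ^ p = ϖ ^ N * w)) → ∃ (A : Subalgebra k K) (h : A.toSubring ≤ O.toSubring), A₀ ≤ A ∧ t ∈ A ∧ A.FG ∧ IsFractionRing A K ∧ IsRegularLocalRing (Localization.AtPrime (Ideal.comap (Subring.inclusion h) (IsLocalRing.maximalIdeal O))) := by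
  intro p hp k K K' _ _ _ _ _ ι O A₀ h₀ t hfg htp hfr hA₀ R hR0 hstep i _ a ha c hc hexit
  classical
  -- a finitely generated model `A₁` of the stage `i`, `R i ≃ (A₁)_centre`
  obtain ⟨A₁, h₁, hle, hfg₁, -, -, e, he⟩ :=
    exists_model_of_sequence_member k K K' ι O A₀ h₀ hfg hA₀ R hR0 hstep i
  have hreg₁ : IsRegularLocalRing
      (Localization.AtPrime (Ideal.comap (Subring.inclusion h₁) (maximalIdeal O))) :=
    IsRegularLocalRing.of_ringEquiv e
  have hfr₁ : IsFractionRing (Algebra.adjoin k (insert t (A₁ : Set K))) K :=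
    isFractionRing_of_le (adjoin_insert_mono' hle t) hfr
  have htpa : ι a ∈ A₁.toSubring := by rw [ha]; exact hle htp
  have hai : e a = algebraMap A₁.toSubring (Localization.AtPrime (Ideal.comap
      (Subring.inclusion h₁) (maximalIdeal O))) ⟨t ^ p, hle htp⟩ := by
    rw [he a htpa]
    congr 1
    exact Subtype.ext ha
  rcases hexit with ⟨g, b, δ, hg, hb, hg0, hδR, hδb0, hδbi, heq⟩ |
    ⟨ϖ, w, N, hϖ, hw, hwi, hw0, hpN, hϖm, hϖsq, heq⟩
  · -- monogenic exit
    obtain ⟨δ', hδ'⟩ := subringDerivation_of_field K' (R i) δ hδR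
    obtain ⟨Δ, hΔ⟩ := exists_derivation_transport_ringEquiv e δ'
    have hunit : IsUnit (δ' ⟨b, hb⟩) := by
      rw [isUnit_subring_iff_inv_mem, hδ']
      exact ⟨hδb0, hδbi⟩
    have heq' : a - ⟨c, hc⟩ ^ p = ⟨g, hg⟩ ^ p * ⟨b, hb⟩ := Subtype.ext (by
      rw [AddSubgroupClass.coe_sub, Subring.coe_pow, Subring.coe_mul, Subring.coe_pow]; exact heq)
    have hg' : e ⟨g, hg⟩ ≠ 0 := fun h0 =>
      hg0 (congrArg Subtype.val (e.injective (h0.trans (map_zero e).symm)))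
    have heq'' : algebraMap A₁.toSubring (Localization.AtPrime (Ideal.comap (Subring.inclusion h₁)
        (maximalIdeal O))) ⟨t ^ p, hle htp⟩ - e ⟨c, hc⟩ ^ p = e ⟨g, hg⟩ ^ p * e ⟨b, hb⟩ := by
      have h1 := congrArg e heq'
      rw [map_sub, map_pow, map_mul, map_pow, hai] at h1
      exact h1
    have hunit' : IsUnit (Δ (e ⟨b, hb⟩)) := by
      rw [hΔ]
      exact hunit.map e
    obtain ⟨A, hA, hle₁, ht, hAfg, hAfr, hAreg⟩ := stub_monogenicExit p hp k K O A₁ h₁ t hfg₁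
      (hle htp) hfr₁ hreg₁ ⟨e ⟨c, hc⟩, e ⟨g, hg⟩, e ⟨b, hb⟩, Δ, hg', heq'', hunit'⟩
    exact ⟨A, hA, hle.trans hle₁, ht, hAfg, hAfr, hAreg⟩
  · -- toroidal exit: a regular system of parameters of `R i` starting with `ϖ`
    obtain ⟨dd, uu, huu0, huuspan, hdimuu⟩ := exists_rsop_cons (L := R i) ⟨ϖ, hϖ⟩ hϖm hϖsq
    have hwunit : IsUnit (⟨w, hw⟩ : R i) := (isUnit_subring_iff_inv_mem _).mpr ⟨hw0, hwi⟩
    have heq' : a - ⟨c, hc⟩ ^ p = ⟨ϖ, hϖ⟩ ^ N * ⟨w, hw⟩ := Subtype.ext (by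
      rw [AddSubgroupClass.coe_sub, Subring.coe_pow, Subring.coe_mul, Subring.coe_pow]; exact heq)
    have hspanL : Ideal.span (Set.range (⇑e ∘ uu)) = maximalIdeal (Localization.AtPrime
        (Ideal.comap (Subring.inclusion h₁) (maximalIdeal O))) := by
      rw [Set.range_comp, ← Ideal.map_span, huuspan, map_ringEquiv_maximalIdeal]
    have hdimL : ringKrullDim (Localization.AtPrime (Ideal.comap (Subring.inclusion h₁)
        (maximalIdeal O))) = ((dd + 1 : ℕ) : WithBot ℕ∞) := by
      rw [← ringKrullDim_eq_of_ringEquiv e, hdimuu]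
    have hMx : ∃ j : Fin (dd + 1), ¬ p ∣ (fun j : Fin (dd + 1) => if j = 0 then N else 0) j :=
      ⟨0, by simpa using hpN⟩
    have hprod : (Finset.univ.prod fun j : Fin (dd + 1) => (⇑e ∘ uu) j ^ (if j = 0 then N else 0)) =
        e ⟨ϖ, hϖ⟩ ^ N := by
      rw [Fin.prod_univ_succ]
      simp [huu0, Fin.succ_ne_zero]
    have heq3 : algebraMap A₁.toSubring (Localization.AtPrime (Ideal.comap (Subring.inclusion h₁)
        (maximalIdeal O))) ⟨t ^ p, hle htp⟩ - e ⟨c, hc⟩ ^ p = e ⟨ϖ, hϖ⟩ ^ N * e ⟨w, hw⟩ := by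
      have h1 := congrArg e heq'
      rw [map_sub, map_pow, map_mul, map_pow, hai] at h1
      exact h1
    obtain ⟨A, hA, hle₁, ht, hAfg, hAfr, hAreg⟩ := stub_toroidalExit p hp k K O A₁ h₁ t hfg₁
      (hle htp) hfr₁ hreg₁ ⟨e ⟨c, hc⟩, dd + 1, ⇑e ∘ uu, fun j => if j = 0 then N else 0, e ⟨w, hw⟩,
        hspanL, hdimL, hwunit.map e, hMx, by
          show _ = (Finset.univ.prod fun j : Fin (dd + 1) => (⇑e ∘ uu) j ^ (if j = 0 then N else 0)) * _
          rw [hprod]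
          exact heq3⟩
    exact ⟨A, hA, hle.trans hle₁, ht, hAfg, hAfr, hAreg⟩

end Summit.ResolutionOfSingularities.ResolutionOfSingularities.Theorems.PfaffLine

end
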